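import Mathlib
import HarnessLib
import Summits.Ventures.LatticeQCDFlow.Exactness.NCMCGeneralSpaceReplicaPooledCLT
import Summits.Ventures.LatticeQCDFlow.Exactness.NCMCGeneralSpaceGammaMethodIntervalForm

/-!
# The replica-POOLED Γ-method error bar is asymptotically exact: `(1/R) Σ_r Γ̂_r(0)·2τ̂_{r,W} → σ²_f` in probability and `P{ |x̄_{R,n} − πf| ≤ z √(V̂_{R,n}/(R n)) } → N(0,1)([−z, z])`, from EVERY family of initial laws

HONEST FRAMING: exact (Metropolis-corrected) sampling algorithms for lattice gauge theory;
figures of merit are autocorrelation/cost numbers at stated couplings and volumes; no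
continuum-physics claim.

Venture `LatticeQCDFlow` (cell pub-lqcd), topic `Exactness`; FANOUT row 13 (`eng-snf`, GEN-23).
NEW WORK of the cell, not a published result; no definition is introduced; nothing is cited as a
fact (the replica-pooled Γ-method — U. Wolff, Comput. Phys. Commun. 156 (2004) 143, §3.3 — is NAMED
ONLY).  With `R` replicas of equal length `n` and per-replica centring, Wolff's pooled autocovariance
function `Γ̄(t) = Σ_r S_r(t)/(R n − R t)` is the replica AVERAGE `(1/R) Σ_r Γ̂_r(t)` of scorer A's
one-stream estimates (row 11's `Scoring.gammaHat`), so the pooled variance statistic with a common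
window `W` is `V̂_{R,n} = Γ̄(0) + 2 Σ_{t≤W} Γ̄(t) = (1/R) Σ_r Γ̂_r(0) · 2 τ̂_{r,W}` — the replica average of
the one-stream Γ-method statistics GEN-20 proved consistent from every start
(`chain_gammaWindow_tendstoInMeasure_of_nHit`, `NCMCGeneralSpaceGammaMethodConsistency`).  Averages of
coordinates consistent in probability are consistent on the product (`tendstoInMeasure_pi_avg`, GEN-23
`NCMCGeneralSpaceReplicaSumCLT`), the pooled sum is asymptotically `N(0, σ²_f)` at the pooled sample
size (`tendstoInDistribution_pooledSum_of_nHit`, GEN-23 `NCMCGeneralSpaceReplicaPooledCLT`), and GEN-20's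
plug-in coverage lemma (`tendsto_measure_abs_mul_le_of_clt_of_tendstoInMeasure`) and interval algebra
(`abs_studentized_le_iff`, `tendsto_measure_of_eq_off_vanishing`) finish exactly as along one stream.

## Content (`κ` Markov on `S`, `π` invariant, `(nHit κ m)(z, ·) ≥ ε ν` for all `z`, `ε ≠ 0`, `0 < m`;
## `|f| ≤ C` measurable; `σ²_f = C_f̄(0) + 2 Σ_{t≥1} C_f̄(t)`; `R = card ι ≥ 1` replicas started from ANY
## laws `μ r`, replica law `⊗_r P_{μ r}`; windows `W_n → ∞`, `W_n³/n → 0`;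
## `V̂_{R,n}(x) = (Σ_r Γ̂_n(0)[f∘x^r] · 2 τ̂_{n,W_n}[f∘x^r]) / R`)

* `measurable_pooledGammaWindow`;
* **`pooledGammaWindow_tendstoInMeasure_of_nHit`** — `V̂_{R,n} → σ²_f` in probability under the replica
  law, EVERY family of starts (no positivity needed);
* **`tendstoInDistribution_studentized_pooledSum_of_nHit`** — `σ²_f > 0`:
  `(√(R n))⁻¹ Σ_r Σ_{t<n} (f(x^r_t) − πf) · (√V̂_{R,n})⁻¹ ⇒ N(0, 1)`;
* **`tendsto_measure_studentized_pooledSum_le_of_nHit`** — for every `z > 0` the probability of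
  `{|…| ≤ z}` tends to `gaussianReal 0 1 (Icc (−z) z)`;
* **`tendsto_measure_pooledMean_mem_gammaInterval_of_nHit`** — THE PRINTED FORM: with
  `x̄_{R,n} = (Σ_r Σ_{t<n} f(x^r_t))/(R n)`,
  `P{ |x̄_{R,n} − πf| ≤ z √(V̂_{R,n}/(R n)) } → gaussianReal 0 1 (Icc (−z) z)`;
  `…_of_minorised` (`m = 1`).

NOT CLAIMED: dependent replicas; unequal lengths; centring at the POOLED mean instead of the replica
means (Wolff's default — it differs from `V̂_{R,n}` by a term that vanishes in probability; not typed
here); the data-driven window; `σ²_f > 0` itself (GEN-21/22 give sufficient conditions); anything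
numerical.
-/

namespace Summit.Ventures.LatticeQCDFlow.Exactness.GeneralNCMC

open MeasureTheory ProbabilityTheory Set Filter Finset
open scoped ENNReal NNReal Topology

variable {S : Type*} [MeasurableSpace S]

section Pooled

variable {κ : Kernel S S} [IsMarkovKernel κ] {π : Measure S} [IsProbabilityMeasure π]
  {ν : Measure S} [IsProbabilityMeasure ν] {ε : ℝ≥0∞} {m : ℕ}
  {ι : Type*} [Fintype ι] [Nonempty ι]

omit [Nonempty ι] in
/-- The pooled Γ-method statistic is a measurable function of the replica paths. -/
theorem measurable_pooledGammaWindow {f : S → ℝ} (hf : Measurable f) (N W : ℕ) :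
    Measurable fun x : ι → ℕ → S => (∑ r, Scoring.gammaHat (fun i => f (x r i)) N 0
        * (2 * Scoring.tauIntWindow (Scoring.rhoHat (fun i => f (x r i)) N) W)) / Fintype.card ι :=
  (Finset.measurable_sum _ fun r _ =>
    (measurable_gammaWindow hf N W).comp (measurable_pi_apply r)).div_const _

/-- **THE POOLED Γ-METHOD STATISTIC IS CONSISTENT, EVERY FAMILY OF STARTS.**  `κ` Markov, `π`
invariant, `(nHit κ m)(z, ·) ≥ ε ν` (`ε ≠ 0`, `0 < m`), `|f| ≤ C` measurable; windows `W_N → ∞`,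
`W_N³/N → 0`; replicas started from ANY laws `μ r`.  Then
`(Σ_r Γ̂_N(0)[f∘x^r] · 2 τ̂_{N,W_N}[f∘x^r]) / R → σ²_f` in probability under the replica law. -/
theorem pooledGammaWindow_tendstoInMeasure_of_nHit (hπ : Kernel.Invariant κ π) (hε : ε ≠ 0)
    (hmin : ∀ z, ε • ν ≤ nHit κ m z) (hm : 0 < m)
    {f : S → ℝ} (hf : Measurable f) {C : ℝ} (hC : ∀ x, |f x| ≤ C)
    {W : ℕ → ℕ} (hW : Tendsto W atTop atTop) (hW3 : Tendsto (fun N => (W N : ℝ) ^ 3 / N) atTop (𝓝 0))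
    (μ : ι → Measure S) [∀ r, IsProbabilityMeasure (μ r)]
    [∀ r, IsProbabilityMeasure (Kernel.trajMeasure (X := fun _ : ℕ => S) (μ r)
        (fun n : ℕ => κ.comap (fun hh : (i : ↥(Finset.Iic n)) → S => hh ⟨n, Finset.mem_Iic.2 le_rfl⟩)
          (measurable_pi_apply _)))] :
    TendstoInMeasure (Measure.pi fun r => Kernel.trajMeasure (X := fun _ : ℕ => S) (μ r)
        (fun n : ℕ => κ.comap (fun hh : (i : ↥(Finset.Iic n)) → S => hh ⟨n, Finset.mem_Iic.2 le_rfl⟩)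
          (measurable_pi_apply _)))
      (fun (N : ℕ) (x : ι → ℕ → S) => (∑ r, Scoring.gammaHat (fun i => f (x r i)) N 0
        * (2 * Scoring.tauIntWindow (Scoring.rhoHat (fun i => f (x r i)) N) (W N))) / Fintype.card ι)
      atTop (fun _ => Scoring.autocov κ π (fun y => f y - ∫ z, f z ∂π) 0
        + 2 * ∑' t, Scoring.autocov κ π (fun y => f y - ∫ z, f z ∂π) (t + 1)) := by
  haveI : Nonempty S := nonempty_of_isProbabilityMeasure π
  have hε1 : ε ≤ 1 := by
    haveI := isMarkovKernel_nHit κ m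
    exact eps_le_one_of_minorised hmin
  exact tendstoInMeasure_pi_avg
    (P := fun r => Kernel.trajMeasure (X := fun _ : ℕ => S) (μ r)
      (fun n : ℕ => κ.comap (fun hh : (i : ↥(Finset.Iic n)) → S => hh ⟨n, Finset.mem_Iic.2 le_rfl⟩)
        (measurable_pi_apply _)))
    (T := fun (_r : ι) (N : ℕ) (x : ℕ → S) => Scoring.gammaHat (fun i => f (x i)) N 0
      * (2 * Scoring.tauIntWindow (Scoring.rhoHat (fun i => f (x i)) N) (W N)))
    (fun _ N => measurable_gammaWindow hf N (W N))
    (fun r => chain_gammaWindow_tendstoInMeasure_of_nHit (μ r)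
      (fun z B hB => minorised_setwise hmin z hB) (pos_iff_ne_zero.2 hε) hε1 hm hπ hf hC hW hW3)

/-- **The pooled plug-in scale converges in probability**: `σ²_f > 0` ⇒
`(√V̂_{R,N})⁻¹ → (√σ²_f)⁻¹` in probability under the replica law. -/
theorem pooled_invSqrt_gammaWindow_tendstoInMeasure_of_nHit (hπ : Kernel.Invariant κ π) (hε : ε ≠ 0)
    (hmin : ∀ z, ε • ν ≤ nHit κ m z) (hm : 0 < m)
    {f : S → ℝ} (hf : Measurable f) {C : ℝ} (hC : ∀ x, |f x| ≤ C)
    (hσ : 0 < Scoring.autocov κ π (fun y => f y - ∫ z, f z ∂π) 0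
        + 2 * ∑' t, Scoring.autocov κ π (fun y => f y - ∫ z, f z ∂π) (t + 1))
    {W : ℕ → ℕ} (hW : Tendsto W atTop atTop) (hW3 : Tendsto (fun N => (W N : ℝ) ^ 3 / N) atTop (𝓝 0))
    (μ : ι → Measure S) [∀ r, IsProbabilityMeasure (μ r)]
    [∀ r, IsProbabilityMeasure (Kernel.trajMeasure (X := fun _ : ℕ => S) (μ r)
        (fun n : ℕ => κ.comap (fun hh : (i : ↥(Finset.Iic n)) → S => hh ⟨n, Finset.mem_Iic.2 le_rfl⟩)
          (measurable_pi_apply _)))] :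
    TendstoInMeasure (Measure.pi fun r => Kernel.trajMeasure (X := fun _ : ℕ => S) (μ r)
        (fun n : ℕ => κ.comap (fun hh : (i : ↥(Finset.Iic n)) → S => hh ⟨n, Finset.mem_Iic.2 le_rfl⟩)
          (measurable_pi_apply _)))
      (fun (N : ℕ) (x : ι → ℕ → S) => (Real.sqrt ((∑ r, Scoring.gammaHat (fun i => f (x r i)) N 0
        * (2 * Scoring.tauIntWindow (Scoring.rhoHat (fun i => f (x r i)) N) (W N))) / Fintype.card ι))⁻¹)
      atTop (fun _ => (Real.sqrt (Scoring.autocov κ π (fun y => f y - ∫ z, f z ∂π) 0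
        + 2 * ∑' t, Scoring.autocov κ π (fun y => f y - ∫ z, f z ∂π) (t + 1)))⁻¹) := by
  have hcons := pooledGammaWindow_tendstoInMeasure_of_nHit hπ hε hmin hm hf hC hW hW3 μ
  have hsq : ContinuousAt (fun v : ℝ => (Real.sqrt v)⁻¹)
      (Scoring.autocov κ π (fun y => f y - ∫ z, f z ∂π) 0
        + 2 * ∑' t, Scoring.autocov κ π (fun y => f y - ∫ z, f z ∂π) (t + 1)) :=
    Real.continuous_sqrt.continuousAt.inv₀ (Real.sqrt_pos.2 hσ).ne'
  exact tendstoInMeasure_comp_continuousAt (g := fun v : ℝ => (Real.sqrt v)⁻¹) hcons hsq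
    (fun N => (measurable_pooledGammaWindow hf N (W N)).sqrt.inv)

/-- **THE STUDENTIZED POOLED CLT WITH THE POOLED Γ-METHOD VARIANCE, EVERY FAMILY OF STARTS.**
`σ²_f > 0`; windows `W_n → ∞`, `W_n³/n → 0`:
`(√(R n))⁻¹ Σ_r Σ_{t<n} (f(x^r_t) − πf) · (√V̂_{R,n})⁻¹ ⇒ N(0, 1)` under the replica law. -/
theorem tendstoInDistribution_studentized_pooledSum_of_nHit (hπ : Kernel.Invariant κ π)
    (hε : ε ≠ 0) (hmin : ∀ z, ε • ν ≤ nHit κ m z) (hm : 0 < m)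
    {f : S → ℝ} (hf : Measurable f) {C : ℝ} (hC : ∀ x, |f x| ≤ C)
    (hσ : 0 < Scoring.autocov κ π (fun y => f y - ∫ z, f z ∂π) 0
        + 2 * ∑' t, Scoring.autocov κ π (fun y => f y - ∫ z, f z ∂π) (t + 1))
    {W : ℕ → ℕ} (hW : Tendsto W atTop atTop) (hW3 : Tendsto (fun N => (W N : ℝ) ^ 3 / N) atTop (𝓝 0))
    (μ : ι → Measure S) [∀ r, IsProbabilityMeasure (μ r)]
    [∀ r, IsProbabilityMeasure (Kernel.trajMeasure (X := fun _ : ℕ => S) (μ r)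
        (fun n : ℕ => κ.comap (fun hh : (i : ↥(Finset.Iic n)) → S => hh ⟨n, Finset.mem_Iic.2 le_rfl⟩)
          (measurable_pi_apply _)))] :
    TendstoInDistribution (fun (n : ℕ) (x : ι → ℕ → S) =>
        ((Real.sqrt ((Fintype.card ι : ℝ) * n))⁻¹ * ∑ r, ∑ t ∈ range n, (f (x r t) - ∫ z, f z ∂π))
          * (Real.sqrt ((∑ r, Scoring.gammaHat (fun i => f (x r i)) n 0
            * (2 * Scoring.tauIntWindow (Scoring.rhoHat (fun i => f (x r i)) n) (W n)))
              / Fintype.card ι))⁻¹)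
      atTop id (fun _ => Measure.pi fun r => Kernel.trajMeasure (X := fun _ : ℕ => S) (μ r)
        (fun n : ℕ => κ.comap (fun hh : (i : ↥(Finset.Iic n)) → S => hh ⟨n, Finset.mem_Iic.2 le_rfl⟩)
          (measurable_pi_apply _))) (gaussianReal 0 1) := by
  set σ2 := Scoring.autocov κ π (fun y => f y - ∫ z, f z ∂π) 0
    + 2 * ∑' t, Scoring.autocov κ π (fun y => f y - ∫ z, f z ∂π) (t + 1) with hσ2
  have hclt := tendstoInDistribution_pooledSum_of_nHit hπ hε hmin hm hf hC μ
    (P' := gaussianReal 0 σ2.toNNReal) (Y := id) HasLaw.id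
  have hB := pooled_invSqrt_gammaWindow_tendstoInMeasure_of_nHit hπ hε hmin hm hf hC hσ hW hW3 μ
  have hBm : ∀ n, Measurable fun x : ι → ℕ → S => (Real.sqrt ((∑ r, Scoring.gammaHat
      (fun i => f (x r i)) n 0 * (2 * Scoring.tauIntWindow (Scoring.rhoHat (fun i => f (x r i)) n)
        (W n))) / Fintype.card ι))⁻¹ := fun n => (measurable_pooledGammaWindow hf n (W n)).sqrt.inv
  have hXB := hclt.continuous_comp_prodMk_of_tendstoInMeasure_const
    (g := fun p : ℝ × ℝ => p.1 * p.2) (by fun_prop) hB (fun n => (hBm n).aemeasurable)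
  have hb2 : NNReal.mk (((Real.sqrt σ2)⁻¹) ^ 2) (sq_nonneg _) * σ2.toNNReal = 1 := by
    apply NNReal.eq
    rw [NNReal.coe_mul, NNReal.coe_mk, Real.coe_toNNReal _ hσ.le, NNReal.coe_one, inv_pow,
      Real.sq_sqrt hσ.le, inv_mul_cancel₀ hσ.ne']
  have hlaw : HasLaw (fun ω : ℝ => id ω * (Real.sqrt σ2)⁻¹) (gaussianReal 0 1)
      (gaussianReal 0 σ2.toNNReal) := by
    have h := gaussianReal_mul_const (HasLaw.id (μ := gaussianReal 0 σ2.toNNReal)) (Real.sqrt σ2)⁻¹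
    rwa [mul_zero, hb2] at h
  refine ⟨hXB.forall_aemeasurable, aemeasurable_id, ?_⟩
  have ht := hXB.tendsto
  have heq : (⟨(gaussianReal 0 1).map id, Measure.isProbabilityMeasure_map aemeasurable_id⟩ :
      ProbabilityMeasure ℝ)
      = ⟨(gaussianReal 0 σ2.toNNReal).map (fun ω : ℝ => id ω * (Real.sqrt σ2)⁻¹),
        Measure.isProbabilityMeasure_map hXB.aemeasurable_limit⟩ := by
    apply Subtype.ext
    show (gaussianReal 0 1).map id = (gaussianReal 0 σ2.toNNReal).map (fun ω : ℝ => id ω * (Real.sqrt σ2)⁻¹)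
    rw [Measure.map_id, hlaw.map_eq]
  rw [heq]
  exact ht

/-- **THE POOLED Γ-METHOD ERROR BAR HAS ASYMPTOTICALLY EXACT COVERAGE, EVERY FAMILY OF STARTS.**
For every `z > 0`:
`P{ |(√(R n))⁻¹ Σ_r Σ_{t<n} (f(x^r_t) − πf) · (√V̂_{R,n})⁻¹| ≤ z } → gaussianReal 0 1 (Icc (−z) z)`. -/
theorem tendsto_measure_studentized_pooledSum_le_of_nHit (hπ : Kernel.Invariant κ π)
    (hε : ε ≠ 0) (hmin : ∀ z, ε • ν ≤ nHit κ m z) (hm : 0 < m)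
    {f : S → ℝ} (hf : Measurable f) {C : ℝ} (hC : ∀ x, |f x| ≤ C)
    (hσ : 0 < Scoring.autocov κ π (fun y => f y - ∫ z, f z ∂π) 0
        + 2 * ∑' t, Scoring.autocov κ π (fun y => f y - ∫ z, f z ∂π) (t + 1))
    {W : ℕ → ℕ} (hW : Tendsto W atTop atTop) (hW3 : Tendsto (fun N => (W N : ℝ) ^ 3 / N) atTop (𝓝 0))
    (μ : ι → Measure S) [∀ r, IsProbabilityMeasure (μ r)] {z : ℝ} (hz : 0 < z)
    [∀ r, IsProbabilityMeasure (Kernel.trajMeasure (X := fun _ : ℕ => S) (μ r)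
        (fun n : ℕ => κ.comap (fun hh : (i : ↥(Finset.Iic n)) → S => hh ⟨n, Finset.mem_Iic.2 le_rfl⟩)
          (measurable_pi_apply _)))] :
    Tendsto (fun n : ℕ => (Measure.pi fun r => Kernel.trajMeasure (X := fun _ : ℕ => S) (μ r)
        (fun n : ℕ => κ.comap (fun hh : (i : ↥(Finset.Iic n)) → S => hh ⟨n, Finset.mem_Iic.2 le_rfl⟩)
          (measurable_pi_apply _)))
        {x : ι → ℕ → S | |((Real.sqrt ((Fintype.card ι : ℝ) * n))⁻¹
            * ∑ r, ∑ t ∈ range n, (f (x r t) - ∫ z, f z ∂π))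
          * (Real.sqrt ((∑ r, Scoring.gammaHat (fun i => f (x r i)) n 0
            * (2 * Scoring.tauIntWindow (Scoring.rhoHat (fun i => f (x r i)) n) (W n)))
              / Fintype.card ι))⁻¹| ≤ z})
      atTop (𝓝 (gaussianReal 0 1 (Icc (-z) z))) := by
  set σ2 := Scoring.autocov κ π (fun y => f y - ∫ z, f z ∂π) 0
    + 2 * ∑' t, Scoring.autocov κ π (fun y => f y - ∫ z, f z ∂π) (t + 1) with hσ2
  have hclt := tendstoInDistribution_pooledSum_of_nHit hπ hε hmin hm hf hC μ
    (P' := gaussianReal 0 σ2.toNNReal) (Y := id) HasLaw.id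
  have hB := pooled_invSqrt_gammaWindow_tendstoInMeasure_of_nHit hπ hε hmin hm hf hC hσ hW hW3 μ
  have hBm : ∀ n, Measurable fun x : ι → ℕ → S => (Real.sqrt ((∑ r, Scoring.gammaHat
      (fun i => f (x r i)) n 0 * (2 * Scoring.tauIntWindow (Scoring.rhoHat (fun i => f (x r i)) n)
        (W n))) / Fintype.card ι))⁻¹ := fun n => (measurable_pooledGammaWindow hf n (W n)).sqrt.inv
  have h := tendsto_measure_abs_mul_le_of_clt_of_tendstoInMeasure hBm HasLaw.id hclt hB hz
  have hb2 : NNReal.mk (((Real.sqrt σ2)⁻¹) ^ 2) (sq_nonneg _) * σ2.toNNReal = 1 := by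
    apply NNReal.eq
    rw [NNReal.coe_mul, NNReal.coe_mk, Real.coe_toNNReal _ hσ.le, NNReal.coe_one, inv_pow,
      Real.sq_sqrt hσ.le, inv_mul_cancel₀ hσ.ne']
  rw [hb2] at h
  exact h

/-- **THE PRINTED POOLED INTERVAL CONTAINS `πf` WITH ASYMPTOTICALLY NOMINAL PROBABILITY, EVERY FAMILY
OF STARTS**: with `x̄_{R,n} = (Σ_r Σ_{t<n} f(x^r_t))/(R n)` and the pooled statistic `V̂_{R,n}`,
`P{ |x̄_{R,n} − πf| ≤ z √(V̂_{R,n}/(R n)) } → gaussianReal 0 1 (Icc (−z) z)` for every `z > 0`. -/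
theorem tendsto_measure_pooledMean_mem_gammaInterval_of_nHit (hπ : Kernel.Invariant κ π)
    (hε : ε ≠ 0) (hmin : ∀ z, ε • ν ≤ nHit κ m z) (hm : 0 < m)
    {f : S → ℝ} (hf : Measurable f) {C : ℝ} (hC : ∀ x, |f x| ≤ C)
    (hσ : 0 < Scoring.autocov κ π (fun y => f y - ∫ z, f z ∂π) 0
        + 2 * ∑' t, Scoring.autocov κ π (fun y => f y - ∫ z, f z ∂π) (t + 1))
    {W : ℕ → ℕ} (hW : Tendsto W atTop atTop) (hW3 : Tendsto (fun N => (W N : ℝ) ^ 3 / N) atTop (𝓝 0))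
    (μ : ι → Measure S) [∀ r, IsProbabilityMeasure (μ r)] {z : ℝ} (hz : 0 < z)
    [∀ r, IsProbabilityMeasure (Kernel.trajMeasure (X := fun _ : ℕ => S) (μ r)
        (fun n : ℕ => κ.comap (fun hh : (i : ↥(Finset.Iic n)) → S => hh ⟨n, Finset.mem_Iic.2 le_rfl⟩)
          (measurable_pi_apply _)))] :
    Tendsto (fun n : ℕ => (Measure.pi fun r => Kernel.trajMeasure (X := fun _ : ℕ => S) (μ r)
        (fun n : ℕ => κ.comap (fun hh : (i : ↥(Finset.Iic n)) → S => hh ⟨n, Finset.mem_Iic.2 le_rfl⟩)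
          (measurable_pi_apply _)))
        {x : ι → ℕ → S | |(∑ r, ∑ t ∈ range n, f (x r t)) / ((Fintype.card ι : ℝ) * n) - ∫ z, f z ∂π|
          ≤ z * Real.sqrt (((∑ r, Scoring.gammaHat (fun i => f (x r i)) n 0
            * (2 * Scoring.tauIntWindow (Scoring.rhoHat (fun i => f (x r i)) n) (W n)))
              / Fintype.card ι) / ((Fintype.card ι : ℝ) * n))})
      atTop (𝓝 (gaussianReal 0 1 (Icc (-z) z))) := by
  set P := Measure.pi fun r => Kernel.trajMeasure (X := fun _ : ℕ => S) (μ r)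
    (fun n : ℕ => κ.comap (fun hh : (i : ↥(Finset.Iic n)) → S => hh ⟨n, Finset.mem_Iic.2 le_rfl⟩)
      (measurable_pi_apply _)) with hP
  set c := ∫ z, f z ∂π with hc
  set σ2 := Scoring.autocov κ π (fun y => f y - c) 0
    + 2 * ∑' t, Scoring.autocov κ π (fun y => f y - c) (t + 1) with hσ2
  have hR : 0 < (Fintype.card ι : ℝ) := by exact_mod_cast Fintype.card_pos
  -- the studentized coverage
  have hE := tendsto_measure_studentized_pooledSum_le_of_nHit hπ hε hmin hm hf hC hσ hW hW3 μ hz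
  rw [← hP] at hE
  -- the pooled variance statistic converges in probability to `σ² > 0`
  have hcons := pooledGammaWindow_tendstoInMeasure_of_nHit hπ hε hmin hm hf hC hW hW3 μ
  rw [← hP] at hcons
  set V : ℕ → (ι → ℕ → S) → ℝ := fun n x => (∑ r, Scoring.gammaHat (fun i => f (x r i)) n 0
    * (2 * Scoring.tauIntWindow (Scoring.rhoHat (fun i => f (x r i)) n) (W n))) / Fintype.card ι
    with hV
  set B : ℕ → Set (ι → ℕ → S) := fun n => {x | V n x ≤ 0} ∪ {x | n = 0} with hBdef
  have hBt : Tendsto (fun n => P (B n)) atTop (𝓝 0) := by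
    have h1 : Tendsto (fun n => P {x | V n x ≤ 0}) atTop (𝓝 0) := by
      have h := hcons (ENNReal.ofReal σ2) (by simpa using hσ)
      refine tendsto_of_tendsto_of_tendsto_of_le_of_le tendsto_const_nhds h (fun n => bot_le)
        fun n => measure_mono fun x hx => ?_
      simp only [Set.mem_setOf_eq] at hx ⊢
      rw [edist_dist, Real.dist_eq]
      refine ENNReal.ofReal_le_ofReal ?_
      rw [show V n x = (∑ r, Scoring.gammaHat (fun i => f (x r i)) n 0
          * (2 * Scoring.tauIntWindow (Scoring.rhoHat (fun i => f (x r i)) n) (W n))) / Fintype.card ι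
          from rfl] at hx
      rw [abs_sub_comm]
      linarith [le_abs_self (σ2 - (∑ r, Scoring.gammaHat (fun i => f (x r i)) n 0
        * (2 * Scoring.tauIntWindow (Scoring.rhoHat (fun i => f (x r i)) n) (W n))) / Fintype.card ι)]
    have h2 : Tendsto (fun n : ℕ => P {x : ι → ℕ → S | n = 0}) atTop (𝓝 0) := by
      refine tendsto_const_nhds.congr' ?_
      filter_upwards [Filter.eventually_gt_atTop 0] with n hn
      rw [show {x : ι → ℕ → S | n = 0} = ∅ from Set.eq_empty_of_forall_notMem fun x hx => hn.ne' hx,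
        measure_empty]
    have h := h1.add h2
    rw [add_zero] at h
    exact tendsto_of_tendsto_of_tendsto_of_le_of_le tendsto_const_nhds h (fun n => bot_le)
      fun n => measure_union_le _ _
  refine tendsto_measure_of_eq_off_vanishing hBt (fun n => ?_) hE
  -- on `{V > 0} ∩ {n ≠ 0}` the studentized event IS the interval event, with `N = R n`
  have hcast : ∀ n : ℕ, ((Fintype.card ι * n : ℕ) : ℝ) = (Fintype.card ι : ℝ) * n := fun n => by
    push_cast; ring
  ext x
  simp only [hBdef, hV, Set.mem_inter_iff, Set.mem_compl_iff, Set.mem_union, Set.mem_setOf_eq, not_or,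
    not_le]
  constructor
  · rintro ⟨h, hVpos, hn⟩
    refine ⟨?_, hVpos, hn⟩
    have hN0 : 0 < Fintype.card ι * n := Nat.mul_pos Fintype.card_pos (Nat.pos_of_ne_zero hn)
    have key := (abs_studentized_le_iff hN0 (S := ∑ r, ∑ t ∈ range n, (f (x r t) - c)) (z := z)
      hVpos).1
    rw [hcast n] at key
    have hsum : (∑ r, ∑ t ∈ range n, (f (x r t) - c)) / ((Fintype.card ι : ℝ) * n)
        = (∑ r, ∑ t ∈ range n, f (x r t)) / ((Fintype.card ι : ℝ) * n) - c := by
      simp only [Finset.sum_sub_distrib, Finset.sum_const, Finset.card_range, Finset.card_univ,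
        nsmul_eq_mul]
      have hn' : (n : ℝ) ≠ 0 := by exact_mod_cast hn
      field_simp
    rw [hsum] at key
    exact key (by simpa only [mul_assoc] using h)
  · rintro ⟨h, hVpos, hn⟩
    refine ⟨?_, hVpos, hn⟩
    have hN0 : 0 < Fintype.card ι * n := Nat.mul_pos Fintype.card_pos (Nat.pos_of_ne_zero hn)
    have key := (abs_studentized_le_iff hN0 (S := ∑ r, ∑ t ∈ range n, (f (x r t) - c)) (z := z)
      hVpos).2
    rw [hcast n] at key
    have hsum : (∑ r, ∑ t ∈ range n, (f (x r t) - c)) / ((Fintype.card ι : ℝ) * n)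
        = (∑ r, ∑ t ∈ range n, f (x r t)) / ((Fintype.card ι : ℝ) * n) - c := by
      simp only [Finset.sum_sub_distrib, Finset.sum_const, Finset.card_range, Finset.card_univ,
        nsmul_eq_mul]
      have hn' : (n : ℝ) ≠ 0 := by exact_mod_cast hn
      field_simp
    rw [hsum] at key
    simpa only [mul_assoc] using key h

/-- **One-step minorisation** (`κ(z, ·) ≥ ε ν`): the printed pooled interval
`x̄_{R,n} ± z √(V̂_{R,n}/(R n))` covers `πf` with probability tending to `gaussianReal 0 1 (Icc (−z) z)`,
every family of starts. -/
theorem tendsto_measure_pooledMean_mem_gammaInterval_of_minorised (hπ : Kernel.Invariant κ π)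
    (hε : ε ≠ 0) (hmin : ∀ z, ε • ν ≤ κ z)
    {f : S → ℝ} (hf : Measurable f) {C : ℝ} (hC : ∀ x, |f x| ≤ C)
    (hσ : 0 < Scoring.autocov κ π (fun y => f y - ∫ z, f z ∂π) 0
        + 2 * ∑' t, Scoring.autocov κ π (fun y => f y - ∫ z, f z ∂π) (t + 1))
    {W : ℕ → ℕ} (hW : Tendsto W atTop atTop) (hW3 : Tendsto (fun N => (W N : ℝ) ^ 3 / N) atTop (𝓝 0))
    (μ : ι → Measure S) [∀ r, IsProbabilityMeasure (μ r)] {z : ℝ} (hz : 0 < z)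
    [∀ r, IsProbabilityMeasure (Kernel.trajMeasure (X := fun _ : ℕ => S) (μ r)
        (fun n : ℕ => κ.comap (fun hh : (i : ↥(Finset.Iic n)) → S => hh ⟨n, Finset.mem_Iic.2 le_rfl⟩)
          (measurable_pi_apply _)))] :
    Tendsto (fun n : ℕ => (Measure.pi fun r => Kernel.trajMeasure (X := fun _ : ℕ => S) (μ r)
        (fun n : ℕ => κ.comap (fun hh : (i : ↥(Finset.Iic n)) → S => hh ⟨n, Finset.mem_Iic.2 le_rfl⟩)
          (measurable_pi_apply _)))
        {x : ι → ℕ → S | |(∑ r, ∑ t ∈ range n, f (x r t)) / ((Fintype.card ι : ℝ) * n) - ∫ z, f z ∂π|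
          ≤ z * Real.sqrt (((∑ r, Scoring.gammaHat (fun i => f (x r i)) n 0
            * (2 * Scoring.tauIntWindow (Scoring.rhoHat (fun i => f (x r i)) n) (W n)))
              / Fintype.card ι) / ((Fintype.card ι : ℝ) * n))})
      atTop (𝓝 (gaussianReal 0 1 (Icc (-z) z))) := by
  have hmin' : ∀ z, ε • ν ≤ nHit κ 1 z := fun z => by rw [nHit_one]; exact hmin z
  exact tendsto_measure_pooledMean_mem_gammaInterval_of_nHit hπ hε hmin' Nat.one_pos hf hC hσ hW hW3
    μ hz

end Pooled

end Summit.Ventures.LatticeQCDFlow.Exactness.GeneralNCMC
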